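import Summits.QuantumFields.YangMills.Theorems.FlatTubeReductionSlowCauchySchwarz
import Summits.QuantumFields.YangMills.Theorems.FlatTubeReductionGaugeInvariantSlowWeight
import Summits.QuantumFields.YangMills.Theorems.LuscherReductionTwistedTraceScalingBTColourFP
import HarnessLib

/-!
# (A1) THE SLOW INTEGRATION OF THE CAUCHY–SCHWARZ CORE DEFECT WITH COLOUR-AVERAGED MOMENTS: the `u`-integral of the squared pointwise bound of `…CoreTransferMomentsCS` FACTORISES —
# `(∫φI − K_P∫φρ̄)² ≤ (∫φ²ρ̄)·(A·K_P·Σ_m (∫g_mρ̄)·(∫_c T_m) + E·K_P²·∫ρ̄)` — because gauge-invariant slow weights do not see the colour conjugation of the one-site kernel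
# (memo `Cruxes/NearFlatRatioLaw/Lines/ratepack-v7-moments-g18.md` §5 (A1), §7; route `FlatTubeReduction`, crux K1 `NearFlatRatioLaw` stmt-QuantumFields-24720, line «ratepack_v2» skeleton v6,
# stub `stub_hODpot_A`; seat `ym-line-ftr-p1` g18; R2b1 RECORD rung — no summit statement is proved here)

WHY.  At a fixed output point `U = oT u′ x′`, `…CoreTransferMomentsCS.colour_fpFibreTransfer_defect_sq_le_moments` reads, as a function of the input slow datum `u`,
`(I(u) − K_Pρ̄(u))² ≤ A·K_P·ρ̄(u)·(g₀(u)Y₀(u) + g₁(u)(Y₁(u) + Y₂(u)) + g₂(Y₃(u) + Y₄(u))) + E·(K_Pρ̄(u))²`, `Y_m(u) = ∫_c ρ_c(u)·T_m(c) dc`,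
`ρ_c(u) = K₁(c⁻¹u′c, u)/K₁(1,1)`, `ρ̄ = ∫_cρ_c = K̃₁(u′,u)/K₁(1,1)`, with GAUGE-INVARIANT slow coefficients `g₀ = e₀(u′,u)²`, `g₁ = c₁′(u′,u)²` (polynomials in `orbitDist u` and the
one-site actions) and a constant `g₂ = 9c₂′²`.  Then `∫_u g_m(u)ρ_c(u) du = ∫_u g_m(u)K₁(u′,u)du/K₁(1,1) = ∫_u g_mρ̄ du` for EVERY `c` (the tree's `transferPotential_gaugeTransform`,
✓`integral_avgKernel_mul_eq`), so `∫_u g_mY_m du = (∫g_mρ̄)·(∫_cT_m)` (Fubini), and ✓`sq_slow_defect_le` gives the factorised bound: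
★★★ `sq_slow_defect_le_colour_moments`.  With `…CoreDefectMomentSq.defect_core_sq_integral_le_moment` this is the `u′/v′`-separated `Φ` of memo §7.
* §1 `integral_gaugeInv_mul_conjKernel_eq` — `∫ g(u)·K₁(c⁻¹u′c,u) du = ∫ g(u)·K̃₁(u′,u) du` for gauge-invariant bounded measurable `g` (any `c`);
  `integral_gaugeInv_mul_colourMoment_eq` — `∫_u g(u)·(∫_c ρ_c(u)T(c)dc) du = (∫_u g ρ̄)·(∫_c T)` (Fubini);
* §2 ★★★ `sq_slow_defect_le_colour_moments`.
HONEST FRAMING: measure-theoretic bookkeeping for a stub of the CONDITIONAL reduction route R2b1 (rate twin); femto rung R2b1 (RECORD label); not infinite volume, not a mass gap,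
not Clay.  No defs, no named facts, no `sorry`.
-/

set_option autoImplicit false

noncomputable section

open MeasureTheory Filter Topology Real
open scoped BigOperators
open Literature.MathematicalPhysics.QuantumFieldTheory
open Literature.MathematicalPhysics.QuantumLattice

namespace Summit.QuantumFields.YangMills.Theorems.FemtoTransferGap.TwoLattice.ConstTube

open Summit.QuantumFields.YangMills.Theorems.FemtoTransferGap
open Summit.QuantumFields.YangMills.Theorems.FemtoTransferGap.TwoLattice
open Summit.QuantumFields.YangMills.Theorems.FemtoTransferGap.TwoLattice.Avg

/-! ## §1 Gauge-invariant slow weights against the conjugated one-site kernel -/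

/-- `∫ g(u)·K₁(c⁻¹u′c, u) du = ∫ g(u)·K̃₁(u′,u) du` for gauge-invariant bounded measurable `g` and every colour `c`. [cite: SeilerLNP1982, §3] -/
theorem integral_gaugeInv_mul_conjKernel_eq (B : ℝ) {g : GaugeConfig 3 1 SU2 → ℝ} (hgm : Measurable g) {Cg : ℝ} (hCg : ∀ u, |g u| ≤ Cg)
    (hgi : ∀ (h : Site 3 1 → SU2) (u : GaugeConfig 3 1 SU2), g (gaugeTransform h u) = g u) (c : SU2) (u' : GaugeConfig 3 1 SU2) :
    ∫ u, g u * transferKernel su2Rep B (gaugeTransform (fun _ : Site 3 1 => c⁻¹) u') u ∂configMeasure SU2 1 = ∫ u, g u * avgKernel B u' u ∂configMeasure SU2 1 := by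
  have h1 := transferPotential_gaugeTransform B hgm hgi (fun _ : Site 3 1 => c⁻¹) u'
  have h2 := integral_avgKernel_mul_eq B hgm hCg hgi u'
  have e1 : (fun u => g u * transferKernel su2Rep B (gaugeTransform (fun _ : Site 3 1 => c⁻¹) u') u) = fun u => transferKernel su2Rep B (gaugeTransform (fun _ : Site 3 1 => c⁻¹) u') u * g u := by
    funext u; ring
  have e2 : (fun u => g u * avgKernel B u' u) = fun u => avgKernel B u' u * g u := by funext u; ring
  rw [e1, e2, h1, h2]

/-- ★ **Colour moments against gauge-invariant slow weights factorise**: for gauge-invariant bounded measurable `g` and bounded measurable `T : SU2 → ℝ`,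
`∫_u g(u)·(∫_c (K₁(c⁻¹u′c,u)/K₁(1,1))·T(c) dc) du = (∫_u g(u)·K̃₁(u′,u)/K₁(1,1) du)·(∫_c T(c) dc)`. [folklore] -/
theorem integral_gaugeInv_mul_colourMoment_eq (B : ℝ) {g : GaugeConfig 3 1 SU2 → ℝ} (hgm : Measurable g) {Cg : ℝ} (hCg : ∀ u, |g u| ≤ Cg)
    (hgi : ∀ (h : Site 3 1 → SU2) (u : GaugeConfig 3 1 SU2), g (gaugeTransform h u) = g u) {T : SU2 → ℝ} (hTm : Measurable T) {CT : ℝ} (hCT : ∀ c, |T c| ≤ CT)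
    (u' : GaugeConfig 3 1 SU2) :
    ∫ u, g u * ∫ c, transferKernel su2Rep B (gaugeTransform (fun _ : Site 3 1 => c⁻¹) u') u / transferKernel su2Rep B (1 : GaugeConfig 3 1 SU2) 1 * T c ∂haarProbability SU2
        ∂configMeasure SU2 1 =
      (∫ u, g u * (avgKernel B u' u / transferKernel su2Rep B (1 : GaugeConfig 3 1 SU2) 1) ∂configMeasure SU2 1) * ∫ c, T c ∂haarProbability SU2 := by
  haveI : SecondCountableTopology SU2 := secondCountableTopology_su2
  set K1 : ℝ := transferKernel su2Rep B (1 : GaugeConfig 3 1 SU2) 1 with hK1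
  have hK1p : 0 < K1 := transferKernel_pos _ _ _ _
  obtain ⟨M, hM⟩ := exists_transferKernel_le su2Rep continuous_su2Rep B (L := 1)
  have hM0 : 0 ≤ M := (transferKernel_pos su2Rep B (1 : GaugeConfig 3 1 SU2) 1).le.trans (hM 1 1)
  have hCg0 : 0 ≤ Cg := (abs_nonneg _).trans (hCg 1)
  have hCT0 : 0 ≤ CT := (abs_nonneg _).trans (hCT 1)
  -- the joint integrand `(u, c) ↦ g(u)·ρ_c(u)·T(c)`
  have hKm : Measurable fun p : GaugeConfig 3 1 SU2 × GaugeConfig 3 1 SU2 => transferKernel su2Rep B p.1 p.2 := measurable_transferKernel_lat B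
  have hconj : Measurable fun p : GaugeConfig 3 1 SU2 × SU2 => gaugeTransform (fun _ : Site 3 1 => p.2⁻¹) u' := by
    have hcu : Measurable fun _ : GaugeConfig 3 1 SU2 × SU2 => u' := measurable_const
    have h := (measurable_constGaugeAction (L := 1)).comp (hcu.prodMk (measurable_inv.comp measurable_snd))
    simpa only [Function.comp_def] using h
  have hρm : Measurable fun p : GaugeConfig 3 1 SU2 × SU2 => transferKernel su2Rep B (gaugeTransform (fun _ : Site 3 1 => p.2⁻¹) u') p.1 := by
    have h := hKm.comp (hconj.prodMk measurable_fst); simpa only [Function.comp_def] using h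
  have hjm : Measurable fun p : GaugeConfig 3 1 SU2 × SU2 => g p.1 * (transferKernel su2Rep B (gaugeTransform (fun _ : Site 3 1 => p.2⁻¹) u') p.1 / K1 * T p.2) :=
    (hgm.comp measurable_fst).mul ((hρm.div_const _).mul (hTm.comp measurable_snd))
  have hjb : ∀ p : GaugeConfig 3 1 SU2 × SU2, |g p.1 * (transferKernel su2Rep B (gaugeTransform (fun _ : Site 3 1 => p.2⁻¹) u') p.1 / K1 * T p.2)| ≤ Cg * (M / K1 * CT) := fun p => by
    rw [abs_mul, abs_mul, abs_div, abs_of_pos (transferKernel_pos _ _ _ _), abs_of_pos hK1p]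
    exact mul_le_mul (hCg _) (mul_le_mul (div_le_div_of_nonneg_right (hM _ _) hK1p.le) (hCT _) (abs_nonneg _) (div_nonneg hM0 hK1p.le))
      (mul_nonneg (div_nonneg (transferKernel_pos _ _ _ _).le hK1p.le) (abs_nonneg _)) hCg0
  have hjint : Integrable (fun p : GaugeConfig 3 1 SU2 × SU2 => g p.1 * (transferKernel su2Rep B (gaugeTransform (fun _ : Site 3 1 => p.2⁻¹) u') p.1 / K1 * T p.2))
      ((configMeasure SU2 1).prod (haarProbability SU2)) := integrable_of_measurable_abs_le _ hjm hjb
  -- `∫_u g·(∫_c ρ_cT) = ∫_u∫_c g ρ_c T = ∫_c∫_u g ρ_c T = ∫_c T·(∫_u g ρ_c) = ∫_c T·(∫_u g ρ̄) `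
  have h1 : ∫ u, g u * ∫ c, transferKernel su2Rep B (gaugeTransform (fun _ : Site 3 1 => c⁻¹) u') u / K1 * T c ∂haarProbability SU2 ∂configMeasure SU2 1 =
      ∫ u, ∫ c, g u * (transferKernel su2Rep B (gaugeTransform (fun _ : Site 3 1 => c⁻¹) u') u / K1 * T c) ∂haarProbability SU2 ∂configMeasure SU2 1 := by
    refine integral_congr_ae (ae_of_all _ fun u => ?_); dsimp only; rw [integral_const_mul]
  rw [h1, integral_integral_swap hjint]
  have hinner : ∀ c : SU2, ∫ u, g u * (transferKernel su2Rep B (gaugeTransform (fun _ : Site 3 1 => c⁻¹) u') u / K1 * T c) ∂configMeasure SU2 1 =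
      T c * ((∫ u, g u * (avgKernel B u' u / K1) ∂configMeasure SU2 1)) := by
    intro c
    have e : (fun u => g u * (transferKernel su2Rep B (gaugeTransform (fun _ : Site 3 1 => c⁻¹) u') u / K1 * T c)) =
        fun u => T c / K1 * (g u * transferKernel su2Rep B (gaugeTransform (fun _ : Site 3 1 => c⁻¹) u') u) := by funext u; ring
    rw [e, integral_const_mul, integral_gaugeInv_mul_conjKernel_eq B hgm hCg hgi c u']
    have e2 : (fun u => g u * (avgKernel B u' u / K1)) = fun u => K1⁻¹ * (g u * avgKernel B u' u) := by funext u; ring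
    rw [e2, integral_const_mul]
    field_simp
  simp_rw [hinner]
  rw [integral_mul_const, mul_comm]

/-! ## §2 ★★★ The slow integration with colour-averaged moments -/

/-- ★★★ **SLOW INTEGRATION OF THE CAUCHY–SCHWARZ CORE DEFECT WITH COLOUR MOMENTS.**  One-site data at coupling `B`: bounded measurable `φ, I : SU(2)³ → ℝ`; an output slow datum `u′`;
`ρ̄(u) = K̃₁(u′,u)/K₁(1,1)`, `ρ_c(u) = K₁(c⁻¹u′c,u)/K₁(1,1)`; five bounded measurable colour functions `T₀,…,T₄ ≥ 0`; gauge-invariant bounded measurable slow weights `g₀, g₁ ≥ 0` and a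
constant `g₂ ≥ 0`; a constant `K_P ≥ 0`, reals `A, E`; and the pointwise bound
`(I(u) − K_Pρ̄(u))² ≤ A·K_Pρ̄(u)·(g₀(u)Y₀(u) + g₁(u)(Y₁(u)+Y₂(u)) + g₂(Y₃(u)+Y₄(u))) + E·(K_Pρ̄(u))²`, `Y_m(u) = ∫_cρ_c(u)T_m(c)dc`.  Then
`(∫φI − K_P∫φρ̄)² ≤ (∫φ²ρ̄)·(A·K_P·((∫g₀ρ̄)(∫T₀) + (∫g₁ρ̄)(∫T₁ + ∫T₂) + g₂(∫ρ̄)(∫T₃ + ∫T₄)) + E·K_P²·∫ρ̄)`. [cite: Luscher1983, §3] -/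
theorem sq_slow_defect_le_colour_moments (B : ℝ) {φ I : GaugeConfig 3 1 SU2 → ℝ} (hφm : Measurable φ) (hIm : Measurable I) {Cφ CI : ℝ}
    (hφb : ∀ u, |φ u| ≤ Cφ) (hIb : ∀ u, |I u| ≤ CI) (u' : GaugeConfig 3 1 SU2)
    {T₀ T₁ T₂ T₃ T₄ : SU2 → ℝ} (hT₀m : Measurable T₀) (hT₁m : Measurable T₁) (hT₂m : Measurable T₂) (hT₃m : Measurable T₃) (hT₄m : Measurable T₄)
    (hT₀0 : ∀ c, 0 ≤ T₀ c) (hT₁0 : ∀ c, 0 ≤ T₁ c) (hT₂0 : ∀ c, 0 ≤ T₂ c) (hT₃0 : ∀ c, 0 ≤ T₃ c) (hT₄0 : ∀ c, 0 ≤ T₄ c)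
    {CT : ℝ} (hT₀b : ∀ c, T₀ c ≤ CT) (hT₁b : ∀ c, T₁ c ≤ CT) (hT₂b : ∀ c, T₂ c ≤ CT) (hT₃b : ∀ c, T₃ c ≤ CT) (hT₄b : ∀ c, T₄ c ≤ CT)
    {g₀ g₁ : GaugeConfig 3 1 SU2 → ℝ} (hg₀m : Measurable g₀) (hg₁m : Measurable g₁) (hg₀0 : ∀ u, 0 ≤ g₀ u) (hg₁0 : ∀ u, 0 ≤ g₁ u) {Cg : ℝ} (hg₀b : ∀ u, g₀ u ≤ Cg)
    (hg₁b : ∀ u, g₁ u ≤ Cg) (hg₀i : ∀ (h : Site 3 1 → SU2) (u : GaugeConfig 3 1 SU2), g₀ (gaugeTransform h u) = g₀ u)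
    (hg₁i : ∀ (h : Site 3 1 → SU2) (u : GaugeConfig 3 1 SU2), g₁ (gaugeTransform h u) = g₁ u) {g₂ : ℝ} (hg₂ : 0 ≤ g₂)
    {KP A E : ℝ} (hKP : 0 ≤ KP)
    (hpt : ∀ u, (I u - KP * (avgKernel B u' u / transferKernel su2Rep B (1 : GaugeConfig 3 1 SU2) 1)) ^ 2 ≤
      A * (KP * (avgKernel B u' u / transferKernel su2Rep B (1 : GaugeConfig 3 1 SU2) 1)) *
          (g₀ u * ∫ c, transferKernel su2Rep B (gaugeTransform (fun _ : Site 3 1 => c⁻¹) u') u / transferKernel su2Rep B (1 : GaugeConfig 3 1 SU2) 1 * T₀ c ∂haarProbability SU2 +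
            g₁ u * (∫ c, transferKernel su2Rep B (gaugeTransform (fun _ : Site 3 1 => c⁻¹) u') u / transferKernel su2Rep B (1 : GaugeConfig 3 1 SU2) 1 * T₁ c ∂haarProbability SU2 +
                ∫ c, transferKernel su2Rep B (gaugeTransform (fun _ : Site 3 1 => c⁻¹) u') u / transferKernel su2Rep B (1 : GaugeConfig 3 1 SU2) 1 * T₂ c ∂haarProbability SU2) +
            g₂ * (∫ c, transferKernel su2Rep B (gaugeTransform (fun _ : Site 3 1 => c⁻¹) u') u / transferKernel su2Rep B (1 : GaugeConfig 3 1 SU2) 1 * T₃ c ∂haarProbability SU2 +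
                ∫ c, transferKernel su2Rep B (gaugeTransform (fun _ : Site 3 1 => c⁻¹) u') u / transferKernel su2Rep B (1 : GaugeConfig 3 1 SU2) 1 * T₄ c ∂haarProbability SU2)) +
        E * (KP * (avgKernel B u' u / transferKernel su2Rep B (1 : GaugeConfig 3 1 SU2) 1)) ^ 2) :
    (∫ u, φ u * I u ∂configMeasure SU2 1 - KP * ∫ u, φ u * (avgKernel B u' u / transferKernel su2Rep B (1 : GaugeConfig 3 1 SU2) 1) ∂configMeasure SU2 1) ^ 2 ≤
      (∫ u, φ u ^ 2 * (avgKernel B u' u / transferKernel su2Rep B (1 : GaugeConfig 3 1 SU2) 1) ∂configMeasure SU2 1) *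
        (A * KP * ((∫ u, g₀ u * (avgKernel B u' u / transferKernel su2Rep B (1 : GaugeConfig 3 1 SU2) 1) ∂configMeasure SU2 1) * ∫ c, T₀ c ∂haarProbability SU2 +
            (∫ u, g₁ u * (avgKernel B u' u / transferKernel su2Rep B (1 : GaugeConfig 3 1 SU2) 1) ∂configMeasure SU2 1) * (∫ c, T₁ c ∂haarProbability SU2 + ∫ c, T₂ c ∂haarProbability SU2) +
            g₂ * (∫ u, avgKernel B u' u / transferKernel su2Rep B (1 : GaugeConfig 3 1 SU2) 1 ∂configMeasure SU2 1) * (∫ c, T₃ c ∂haarProbability SU2 + ∫ c, T₄ c ∂haarProbability SU2)) +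
          E * KP ^ 2 * ∫ u, avgKernel B u' u / transferKernel su2Rep B (1 : GaugeConfig 3 1 SU2) 1 ∂configMeasure SU2 1) := by
  haveI : SecondCountableTopology SU2 := secondCountableTopology_su2
  set K1 : ℝ := transferKernel su2Rep B (1 : GaugeConfig 3 1 SU2) 1 with hK1
  have hK1p : 0 < K1 := transferKernel_pos _ _ _ _
  obtain ⟨M, hM⟩ := exists_transferKernel_le su2Rep continuous_su2Rep B (L := 1)
  obtain ⟨mK, hmK, hmKle⟩ := exists_pos_le_transferKernel su2Rep continuous_su2Rep B (L := 1)
  have hM0 : 0 ≤ M := (transferKernel_pos su2Rep B (1 : GaugeConfig 3 1 SU2) 1).le.trans (hM 1 1)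
  have hCT0 : 0 ≤ CT := (hT₀0 1).trans (hT₀b 1)
  have hCg0 : 0 ≤ Cg := (hg₀0 1).trans (hg₀b 1)
  have hKm : Measurable fun p : GaugeConfig 3 1 SU2 × GaugeConfig 3 1 SU2 => transferKernel su2Rep B p.1 p.2 := measurable_transferKernel_lat B
  -- the slow kernel `ρ̄ = K̃₁(u′,·)/K₁(1,1)`: measurable, `0 < mK/K1 ≤ ρ̄ ≤ M/K1`
  have hρm : Measurable (fun u : GaugeConfig 3 1 SU2 => avgKernel B u' u / K1) := (measurable_avgKernel_right B u').div_const _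
  have hρlo : ∀ u, mK / K1 ≤ (fun u : GaugeConfig 3 1 SU2 => avgKernel B u' u / K1) u := fun u => by
    dsimp only
    refine div_le_div_of_nonneg_right ?_ hK1p.le
    unfold avgKernel
    have h := integral_mono (integrable_const mK) (integrable_transferKernel_gaugeTransform_right B u' u) fun g => hmKle u' (gaugeTransform g u)
    simpa [integral_const, probReal_univ] using h
  have hρhi : ∀ u, (fun u : GaugeConfig 3 1 SU2 => avgKernel B u' u / K1) u ≤ M / K1 := fun u => div_le_div_of_nonneg_right (avgKernel_le B hM u' u) hK1p.le
  have hc : 0 < mK / K1 := div_pos hmK hK1p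
  -- the colour moments as functions of `u`: measurable, nonneg, bounded by `(M/K1)·CT`
  have hY : ∀ {T : SU2 → ℝ}, Measurable T → (∀ c, 0 ≤ T c) → (∀ c, T c ≤ CT) →
      Measurable (fun u : GaugeConfig 3 1 SU2 => ∫ c, transferKernel su2Rep B (gaugeTransform (fun _ : Site 3 1 => c⁻¹) u') u / K1 * T c ∂haarProbability SU2) ∧
        (∀ u : GaugeConfig 3 1 SU2, 0 ≤ ∫ c, transferKernel su2Rep B (gaugeTransform (fun _ : Site 3 1 => c⁻¹) u') u / K1 * T c ∂haarProbability SU2) ∧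
        ∀ u : GaugeConfig 3 1 SU2, ∫ c, transferKernel su2Rep B (gaugeTransform (fun _ : Site 3 1 => c⁻¹) u') u / K1 * T c ∂haarProbability SU2 ≤ M / K1 * CT := by
    intro T hTm hT0 hTb
    have hconj : Measurable fun p : GaugeConfig 3 1 SU2 × SU2 => gaugeTransform (fun _ : Site 3 1 => p.2⁻¹) u' := by
      have hcu : Measurable fun _ : GaugeConfig 3 1 SU2 × SU2 => u' := measurable_const
      have h := (measurable_constGaugeAction (L := 1)).comp (hcu.prodMk (measurable_inv.comp measurable_snd))
      simpa only [Function.comp_def] using h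
    have hjm : Measurable fun p : GaugeConfig 3 1 SU2 × SU2 => transferKernel su2Rep B (gaugeTransform (fun _ : Site 3 1 => p.2⁻¹) u') p.1 / K1 * T p.2 := by
      have h := hKm.comp (hconj.prodMk measurable_fst)
      exact ((by simpa only [Function.comp_def] using h : Measurable fun p : GaugeConfig 3 1 SU2 × SU2 =>
        transferKernel su2Rep B (gaugeTransform (fun _ : Site 3 1 => p.2⁻¹) u') p.1).div_const _).mul (hTm.comp measurable_snd)
    refine ⟨(hjm.stronglyMeasurable.integral_prod_right' (ν := haarProbability SU2)).measurable, fun u => integral_nonneg fun c => ?_, fun u => ?_⟩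
    · exact mul_nonneg (div_nonneg (transferKernel_pos _ _ _ _).le hK1p.le) (hT0 c)
    · have hρc : Measurable fun c : SU2 => transferKernel su2Rep B (gaugeTransform (fun _ : Site 3 1 => c⁻¹) u') u := by
        have hc' : Measurable fun c : SU2 => gaugeTransform (fun _ : Site 3 1 => c⁻¹) u' := by
          have hcu : Measurable fun _ : SU2 => u' := measurable_const
          have h := (measurable_constGaugeAction (L := 1)).comp (hcu.prodMk measurable_inv)
          simpa only [Function.comp_def] using h
        have hu0 : Measurable fun _ : SU2 => u := measurable_const
        have h := hKm.comp (hc'.prodMk hu0)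
        simpa only [Function.comp_def] using h
      have hint : Integrable (fun c : SU2 => transferKernel su2Rep B (gaugeTransform (fun _ : Site 3 1 => c⁻¹) u') u / K1 * T c) (haarProbability SU2) :=
        integrable_of_measurable_abs_le _ ((hρc.div_const _).mul hTm) (C := M / K1 * CT) fun c => by
          rw [abs_of_nonneg (mul_nonneg (div_nonneg (transferKernel_pos _ _ _ _).le hK1p.le) (hT0 c))]
          exact mul_le_mul (div_le_div_of_nonneg_right (hM _ _) hK1p.le) (hTb c) (hT0 c) (div_nonneg hM0 hK1p.le)
      calc _ ≤ ∫ _c : SU2, M / K1 * CT ∂haarProbability SU2 := integral_mono hint (integrable_const _) fun c =>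
              mul_le_mul (div_le_div_of_nonneg_right (hM _ _) hK1p.le) (hTb c) (hT0 c) (div_nonneg hM0 hK1p.le)
        _ = M / K1 * CT := by rw [integral_const, smul_eq_mul, probReal_univ, one_mul]
  obtain ⟨hY₀m, hY₀0, hY₀b⟩ := hY hT₀m hT₀0 hT₀b
  obtain ⟨hY₁m, hY₁0, hY₁b⟩ := hY hT₁m hT₁0 hT₁b
  obtain ⟨hY₂m, hY₂0, hY₂b⟩ := hY hT₂m hT₂0 hT₂b
  obtain ⟨hY₃m, hY₃0, hY₃b⟩ := hY hT₃m hT₃0 hT₃b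
  obtain ⟨hY₄m, hY₄0, hY₄b⟩ := hY hT₄m hT₄0 hT₄b
  -- the slow moment density `D(u)` (explicit)
  have hDm : Measurable (fun u : GaugeConfig 3 1 SU2 => g₀ u * ∫ c, transferKernel su2Rep B (gaugeTransform (fun _ : Site 3 1 => c⁻¹) u') u / K1 * T₀ c ∂haarProbability SU2 +
      g₁ u * (∫ c, transferKernel su2Rep B (gaugeTransform (fun _ : Site 3 1 => c⁻¹) u') u / K1 * T₁ c ∂haarProbability SU2 +
          ∫ c, transferKernel su2Rep B (gaugeTransform (fun _ : Site 3 1 => c⁻¹) u') u / K1 * T₂ c ∂haarProbability SU2) +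
      g₂ * (∫ c, transferKernel su2Rep B (gaugeTransform (fun _ : Site 3 1 => c⁻¹) u') u / K1 * T₃ c ∂haarProbability SU2 +
          ∫ c, transferKernel su2Rep B (gaugeTransform (fun _ : Site 3 1 => c⁻¹) u') u / K1 * T₄ c ∂haarProbability SU2)) :=
    ((hg₀m.mul hY₀m).add (hg₁m.mul (hY₁m.add hY₂m))).add ((hY₃m.add hY₄m).const_mul g₂)
  have hD0 : ∀ u, 0 ≤ (fun u : GaugeConfig 3 1 SU2 => g₀ u * ∫ c, transferKernel su2Rep B (gaugeTransform (fun _ : Site 3 1 => c⁻¹) u') u / K1 * T₀ c ∂haarProbability SU2 +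
      g₁ u * (∫ c, transferKernel su2Rep B (gaugeTransform (fun _ : Site 3 1 => c⁻¹) u') u / K1 * T₁ c ∂haarProbability SU2 +
          ∫ c, transferKernel su2Rep B (gaugeTransform (fun _ : Site 3 1 => c⁻¹) u') u / K1 * T₂ c ∂haarProbability SU2) +
      g₂ * (∫ c, transferKernel su2Rep B (gaugeTransform (fun _ : Site 3 1 => c⁻¹) u') u / K1 * T₃ c ∂haarProbability SU2 +
          ∫ c, transferKernel su2Rep B (gaugeTransform (fun _ : Site 3 1 => c⁻¹) u') u / K1 * T₄ c ∂haarProbability SU2)) u := fun u => by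
    have a0 := hY₀0 u; have a1 := hY₁0 u; have a2 := hY₂0 u; have a3 := hY₃0 u; have a4 := hY₄0 u; have b0 := hg₀0 u; have b1 := hg₁0 u
    dsimp only at a0 a1 a2 a3 a4 ⊢
    generalize (∫ c, transferKernel su2Rep B (gaugeTransform (fun _ : Site 3 1 => c⁻¹) u') u / K1 * T₀ c ∂haarProbability SU2) = y0 at a0 ⊢
    generalize (∫ c, transferKernel su2Rep B (gaugeTransform (fun _ : Site 3 1 => c⁻¹) u') u / K1 * T₁ c ∂haarProbability SU2) = y1 at a1 ⊢
    generalize (∫ c, transferKernel su2Rep B (gaugeTransform (fun _ : Site 3 1 => c⁻¹) u') u / K1 * T₂ c ∂haarProbability SU2) = y2 at a2 ⊢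
    generalize (∫ c, transferKernel su2Rep B (gaugeTransform (fun _ : Site 3 1 => c⁻¹) u') u / K1 * T₃ c ∂haarProbability SU2) = y3 at a3 ⊢
    generalize (∫ c, transferKernel su2Rep B (gaugeTransform (fun _ : Site 3 1 => c⁻¹) u') u / K1 * T₄ c ∂haarProbability SU2) = y4 at a4 ⊢
    have := mul_nonneg b0 a0; have := mul_nonneg b1 (add_nonneg a1 a2); have := mul_nonneg hg₂ (add_nonneg a3 a4)
    linarith
  have hDb : ∀ u, |(fun u : GaugeConfig 3 1 SU2 => g₀ u * ∫ c, transferKernel su2Rep B (gaugeTransform (fun _ : Site 3 1 => c⁻¹) u') u / K1 * T₀ c ∂haarProbability SU2 +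
      g₁ u * (∫ c, transferKernel su2Rep B (gaugeTransform (fun _ : Site 3 1 => c⁻¹) u') u / K1 * T₁ c ∂haarProbability SU2 +
          ∫ c, transferKernel su2Rep B (gaugeTransform (fun _ : Site 3 1 => c⁻¹) u') u / K1 * T₂ c ∂haarProbability SU2) +
      g₂ * (∫ c, transferKernel su2Rep B (gaugeTransform (fun _ : Site 3 1 => c⁻¹) u') u / K1 * T₃ c ∂haarProbability SU2 +
          ∫ c, transferKernel su2Rep B (gaugeTransform (fun _ : Site 3 1 => c⁻¹) u') u / K1 * T₄ c ∂haarProbability SU2)) u| ≤ Cg * (M / K1 * CT) + Cg * (2 * (M / K1 * CT)) + g₂ * (2 * (M / K1 * CT)) := fun u => by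
    rw [abs_of_nonneg (hD0 u)]
    have a0 := hY₀0 u; have a1 := hY₁0 u; have a2 := hY₂0 u; have a3 := hY₃0 u; have a4 := hY₄0 u
    have c0 := hY₀b u; have c1 := hY₁b u; have c2 := hY₂b u; have c3 := hY₃b u; have c4 := hY₄b u
    have b0 := hg₀0 u; have b1 := hg₁0 u; have d0 := hg₀b u; have d1 := hg₁b u
    dsimp only at a0 a1 a2 a3 a4 c0 c1 c2 c3 c4 ⊢
    generalize (∫ c, transferKernel su2Rep B (gaugeTransform (fun _ : Site 3 1 => c⁻¹) u') u / K1 * T₀ c ∂haarProbability SU2) = y0 at a0 c0 ⊢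
    generalize (∫ c, transferKernel su2Rep B (gaugeTransform (fun _ : Site 3 1 => c⁻¹) u') u / K1 * T₁ c ∂haarProbability SU2) = y1 at a1 c1 ⊢
    generalize (∫ c, transferKernel su2Rep B (gaugeTransform (fun _ : Site 3 1 => c⁻¹) u') u / K1 * T₂ c ∂haarProbability SU2) = y2 at a2 c2 ⊢
    generalize (∫ c, transferKernel su2Rep B (gaugeTransform (fun _ : Site 3 1 => c⁻¹) u') u / K1 * T₃ c ∂haarProbability SU2) = y3 at a3 c3 ⊢
    generalize (∫ c, transferKernel su2Rep B (gaugeTransform (fun _ : Site 3 1 => c⁻¹) u') u / K1 * T₄ c ∂haarProbability SU2) = y4 at a4 c4 ⊢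
    have e0 := mul_le_mul d0 c0 a0 hCg0
    have e1 := mul_le_mul d1 (add_le_add c1 c2) (add_nonneg a1 a2) hCg0
    have e2 := mul_le_mul_of_nonneg_left (add_le_add c3 c4) hg₂
    linarith
  -- apply the abstract slow Cauchy–Schwarz
  have hmain := sq_slow_defect_le (configMeasure SU2 1) hφm hIm hDm hρm hφb hIb hDb hc hρlo hρhi (KP := KP) (A := A) (E := E) hKP hpt
  beta_reduce at hmain
  -- factorise `∫ D`
  have hIY : ∀ {T : SU2 → ℝ}, Measurable T → (∀ c, 0 ≤ T c) → (∀ c, T c ≤ CT) → ∀ {g : GaugeConfig 3 1 SU2 → ℝ}, Measurable g → (∀ u, 0 ≤ g u) → ∀ {Cg' : ℝ}, (∀ u, g u ≤ Cg') →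
      (∀ (h : Site 3 1 → SU2) (u : GaugeConfig 3 1 SU2), g (gaugeTransform h u) = g u) →
      Integrable (fun u => g u * ∫ c, transferKernel su2Rep B (gaugeTransform (fun _ : Site 3 1 => c⁻¹) u') u / K1 * T c ∂haarProbability SU2) (configMeasure SU2 1) ∧
      ∫ u, g u * ∫ c, transferKernel su2Rep B (gaugeTransform (fun _ : Site 3 1 => c⁻¹) u') u / K1 * T c ∂haarProbability SU2 ∂configMeasure SU2 1 =
        (∫ u, g u * (avgKernel B u' u / K1) ∂configMeasure SU2 1) * ∫ c, T c ∂haarProbability SU2 := by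
    intro T hTm hT0 hTb g hgm hg0 Cg' hgb hgi
    obtain ⟨hYm, hY0', hYb'⟩ := hY hTm hT0 hTb
    have hCg'0 : 0 ≤ Cg' := (hg0 1).trans (hgb 1)
    refine ⟨integrable_of_measurable_abs_le _ (hgm.mul hYm) (C := Cg' * (M / K1 * CT)) fun u => ?_, ?_⟩
    · rw [abs_mul, abs_of_nonneg (hg0 u), abs_of_nonneg (hY0' u)]; exact mul_le_mul (hgb u) (hYb' u) (hY0' u) hCg'0
    · exact integral_gaugeInv_mul_colourMoment_eq B hgm (Cg := Cg') (fun u => by rw [abs_of_nonneg (hg0 u)]; exact hgb u) hgi hTm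
        (CT := CT) (fun c => by rw [abs_of_nonneg (hT0 c)]; exact hTb c) u'
  have hconst_i : ∀ (h : Site 3 1 → SU2) (u : GaugeConfig 3 1 SU2), (fun _ : GaugeConfig 3 1 SU2 => g₂) (gaugeTransform h u) = (fun _ : GaugeConfig 3 1 SU2 => g₂) u :=
    fun _ _ => rfl
  obtain ⟨i0, e0⟩ := hIY hT₀m hT₀0 hT₀b hg₀m hg₀0 hg₀b hg₀i
  obtain ⟨i1, e1⟩ := hIY hT₁m hT₁0 hT₁b hg₁m hg₁0 hg₁b hg₁i
  obtain ⟨i2, e2⟩ := hIY hT₂m hT₂0 hT₂b hg₁m hg₁0 hg₁b hg₁i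
  obtain ⟨i3, e3⟩ := hIY hT₃m hT₃0 hT₃b (g := fun _ => g₂) measurable_const (fun _ => hg₂) (Cg' := g₂) (fun _ => le_rfl) hconst_i
  obtain ⟨i4, e4⟩ := hIY hT₄m hT₄0 hT₄b (g := fun _ => g₂) measurable_const (fun _ => hg₂) (Cg' := g₂) (fun _ => le_rfl) hconst_i
  have hρint : Integrable (fun u : GaugeConfig 3 1 SU2 => avgKernel B u' u / K1) (configMeasure SU2 1) :=
    integrable_of_measurable_abs_le _ hρm (C := M / K1) fun u => by
      rw [abs_of_nonneg (hc.le.trans (hρlo u))]; exact hρhi u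
  have hDint : ∫ u, (fun u : GaugeConfig 3 1 SU2 => g₀ u * ∫ c, transferKernel su2Rep B (gaugeTransform (fun _ : Site 3 1 => c⁻¹) u') u / K1 * T₀ c ∂haarProbability SU2 +
      g₁ u * (∫ c, transferKernel su2Rep B (gaugeTransform (fun _ : Site 3 1 => c⁻¹) u') u / K1 * T₁ c ∂haarProbability SU2 +
          ∫ c, transferKernel su2Rep B (gaugeTransform (fun _ : Site 3 1 => c⁻¹) u') u / K1 * T₂ c ∂haarProbability SU2) +
      g₂ * (∫ c, transferKernel su2Rep B (gaugeTransform (fun _ : Site 3 1 => c⁻¹) u') u / K1 * T₃ c ∂haarProbability SU2 +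
          ∫ c, transferKernel su2Rep B (gaugeTransform (fun _ : Site 3 1 => c⁻¹) u') u / K1 * T₄ c ∂haarProbability SU2)) u ∂configMeasure SU2 1 =
      (∫ u, g₀ u * (avgKernel B u' u / K1) ∂configMeasure SU2 1) * ∫ c, T₀ c ∂haarProbability SU2 +
        (∫ u, g₁ u * (avgKernel B u' u / K1) ∂configMeasure SU2 1) * (∫ c, T₁ c ∂haarProbability SU2 + ∫ c, T₂ c ∂haarProbability SU2) +
        g₂ * (∫ u, avgKernel B u' u / K1 ∂configMeasure SU2 1) * (∫ c, T₃ c ∂haarProbability SU2 + ∫ c, T₄ c ∂haarProbability SU2) := by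
    have eD : ∀ u : GaugeConfig 3 1 SU2, (fun u : GaugeConfig 3 1 SU2 => g₀ u * ∫ c, transferKernel su2Rep B (gaugeTransform (fun _ : Site 3 1 => c⁻¹) u') u / K1 * T₀ c ∂haarProbability SU2 +
      g₁ u * (∫ c, transferKernel su2Rep B (gaugeTransform (fun _ : Site 3 1 => c⁻¹) u') u / K1 * T₁ c ∂haarProbability SU2 +
          ∫ c, transferKernel su2Rep B (gaugeTransform (fun _ : Site 3 1 => c⁻¹) u') u / K1 * T₂ c ∂haarProbability SU2) +
      g₂ * (∫ c, transferKernel su2Rep B (gaugeTransform (fun _ : Site 3 1 => c⁻¹) u') u / K1 * T₃ c ∂haarProbability SU2 +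
          ∫ c, transferKernel su2Rep B (gaugeTransform (fun _ : Site 3 1 => c⁻¹) u') u / K1 * T₄ c ∂haarProbability SU2)) u = (g₀ u * ∫ c, transferKernel su2Rep B (gaugeTransform (fun _ : Site 3 1 => c⁻¹) u') u / K1 * T₀ c ∂haarProbability SU2 +
        (g₁ u * ∫ c, transferKernel su2Rep B (gaugeTransform (fun _ : Site 3 1 => c⁻¹) u') u / K1 * T₁ c ∂haarProbability SU2 +
          g₁ u * ∫ c, transferKernel su2Rep B (gaugeTransform (fun _ : Site 3 1 => c⁻¹) u') u / K1 * T₂ c ∂haarProbability SU2)) +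
        ((fun _ : GaugeConfig 3 1 SU2 => g₂) u * ∫ c, transferKernel su2Rep B (gaugeTransform (fun _ : Site 3 1 => c⁻¹) u') u / K1 * T₃ c ∂haarProbability SU2 +
          (fun _ : GaugeConfig 3 1 SU2 => g₂) u * ∫ c, transferKernel su2Rep B (gaugeTransform (fun _ : Site 3 1 => c⁻¹) u') u / K1 * T₄ c ∂haarProbability SU2) := fun u => by
      dsimp only; ring
    have k12 : Integrable (fun u : GaugeConfig 3 1 SU2 => g₁ u * ∫ c, transferKernel su2Rep B (gaugeTransform (fun _ : Site 3 1 => c⁻¹) u') u / K1 * T₁ c ∂haarProbability SU2 + g₁ u * ∫ c, transferKernel su2Rep B (gaugeTransform (fun _ : Site 3 1 => c⁻¹) u') u / K1 * T₂ c ∂haarProbability SU2) (configMeasure SU2 1) := i1.add i2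
    have k012 : Integrable (fun u : GaugeConfig 3 1 SU2 => g₀ u * ∫ c, transferKernel su2Rep B (gaugeTransform (fun _ : Site 3 1 => c⁻¹) u') u / K1 * T₀ c ∂haarProbability SU2 + (g₁ u * ∫ c, transferKernel su2Rep B (gaugeTransform (fun _ : Site 3 1 => c⁻¹) u') u / K1 * T₁ c ∂haarProbability SU2 + g₁ u * ∫ c, transferKernel su2Rep B (gaugeTransform (fun _ : Site 3 1 => c⁻¹) u') u / K1 * T₂ c ∂haarProbability SU2)) (configMeasure SU2 1) := i0.add k12
    have k34 : Integrable (fun u : GaugeConfig 3 1 SU2 => (fun _ : GaugeConfig 3 1 SU2 => g₂) u * ∫ c, transferKernel su2Rep B (gaugeTransform (fun _ : Site 3 1 => c⁻¹) u') u / K1 * T₃ c ∂haarProbability SU2 + (fun _ : GaugeConfig 3 1 SU2 => g₂) u * ∫ c, transferKernel su2Rep B (gaugeTransform (fun _ : Site 3 1 => c⁻¹) u') u / K1 * T₄ c ∂haarProbability SU2) (configMeasure SU2 1) := i3.add i4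
    have s1 : ∫ u, (g₀ u * ∫ c, transferKernel su2Rep B (gaugeTransform (fun _ : Site 3 1 => c⁻¹) u') u / K1 * T₀ c ∂haarProbability SU2 + (g₁ u * ∫ c, transferKernel su2Rep B (gaugeTransform (fun _ : Site 3 1 => c⁻¹) u') u / K1 * T₁ c ∂haarProbability SU2 + g₁ u * ∫ c, transferKernel su2Rep B (gaugeTransform (fun _ : Site 3 1 => c⁻¹) u') u / K1 * T₂ c ∂haarProbability SU2) + ((fun _ : GaugeConfig 3 1 SU2 => g₂) u * ∫ c, transferKernel su2Rep B (gaugeTransform (fun _ : Site 3 1 => c⁻¹) u') u / K1 * T₃ c ∂haarProbability SU2 + (fun _ : GaugeConfig 3 1 SU2 => g₂) u * ∫ c, transferKernel su2Rep B (gaugeTransform (fun _ : Site 3 1 => c⁻¹) u') u / K1 * T₄ c ∂haarProbability SU2)) ∂configMeasure SU2 1 =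
        (∫ u, (g₀ u * ∫ c, transferKernel su2Rep B (gaugeTransform (fun _ : Site 3 1 => c⁻¹) u') u / K1 * T₀ c ∂haarProbability SU2 + (g₁ u * ∫ c, transferKernel su2Rep B (gaugeTransform (fun _ : Site 3 1 => c⁻¹) u') u / K1 * T₁ c ∂haarProbability SU2 + g₁ u * ∫ c, transferKernel su2Rep B (gaugeTransform (fun _ : Site 3 1 => c⁻¹) u') u / K1 * T₂ c ∂haarProbability SU2)) ∂configMeasure SU2 1) + ∫ u, ((fun _ : GaugeConfig 3 1 SU2 => g₂) u * ∫ c, transferKernel su2Rep B (gaugeTransform (fun _ : Site 3 1 => c⁻¹) u') u / K1 * T₃ c ∂haarProbability SU2 + (fun _ : GaugeConfig 3 1 SU2 => g₂) u * ∫ c, transferKernel su2Rep B (gaugeTransform (fun _ : Site 3 1 => c⁻¹) u') u / K1 * T₄ c ∂haarProbability SU2) ∂configMeasure SU2 1 := integral_add k012 k34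
    have s2 : ∫ u, (g₀ u * ∫ c, transferKernel su2Rep B (gaugeTransform (fun _ : Site 3 1 => c⁻¹) u') u / K1 * T₀ c ∂haarProbability SU2 + (g₁ u * ∫ c, transferKernel su2Rep B (gaugeTransform (fun _ : Site 3 1 => c⁻¹) u') u / K1 * T₁ c ∂haarProbability SU2 + g₁ u * ∫ c, transferKernel su2Rep B (gaugeTransform (fun _ : Site 3 1 => c⁻¹) u') u / K1 * T₂ c ∂haarProbability SU2)) ∂configMeasure SU2 1 = (∫ u, g₀ u * ∫ c, transferKernel su2Rep B (gaugeTransform (fun _ : Site 3 1 => c⁻¹) u') u / K1 * T₀ c ∂haarProbability SU2 ∂configMeasure SU2 1) + ∫ u, (g₁ u * ∫ c, transferKernel su2Rep B (gaugeTransform (fun _ : Site 3 1 => c⁻¹) u') u / K1 * T₁ c ∂haarProbability SU2 + g₁ u * ∫ c, transferKernel su2Rep B (gaugeTransform (fun _ : Site 3 1 => c⁻¹) u') u / K1 * T₂ c ∂haarProbability SU2) ∂configMeasure SU2 1 := integral_add i0 k12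
    have s3 : ∫ u, (g₁ u * ∫ c, transferKernel su2Rep B (gaugeTransform (fun _ : Site 3 1 => c⁻¹) u') u / K1 * T₁ c ∂haarProbability SU2 + g₁ u * ∫ c, transferKernel su2Rep B (gaugeTransform (fun _ : Site 3 1 => c⁻¹) u') u / K1 * T₂ c ∂haarProbability SU2) ∂configMeasure SU2 1 = (∫ u, g₁ u * ∫ c, transferKernel su2Rep B (gaugeTransform (fun _ : Site 3 1 => c⁻¹) u') u / K1 * T₁ c ∂haarProbability SU2 ∂configMeasure SU2 1) + ∫ u, g₁ u * ∫ c, transferKernel su2Rep B (gaugeTransform (fun _ : Site 3 1 => c⁻¹) u') u / K1 * T₂ c ∂haarProbability SU2 ∂configMeasure SU2 1 := integral_add i1 i2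
    have s4 : ∫ u, ((fun _ : GaugeConfig 3 1 SU2 => g₂) u * ∫ c, transferKernel su2Rep B (gaugeTransform (fun _ : Site 3 1 => c⁻¹) u') u / K1 * T₃ c ∂haarProbability SU2 + (fun _ : GaugeConfig 3 1 SU2 => g₂) u * ∫ c, transferKernel su2Rep B (gaugeTransform (fun _ : Site 3 1 => c⁻¹) u') u / K1 * T₄ c ∂haarProbability SU2) ∂configMeasure SU2 1 = (∫ u, (fun _ : GaugeConfig 3 1 SU2 => g₂) u * ∫ c, transferKernel su2Rep B (gaugeTransform (fun _ : Site 3 1 => c⁻¹) u') u / K1 * T₃ c ∂haarProbability SU2 ∂configMeasure SU2 1) + ∫ u, (fun _ : GaugeConfig 3 1 SU2 => g₂) u * ∫ c, transferKernel su2Rep B (gaugeTransform (fun _ : Site 3 1 => c⁻¹) u') u / K1 * T₄ c ∂haarProbability SU2 ∂configMeasure SU2 1 := integral_add i3 i4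
    have eg : ∫ u, (fun _ : GaugeConfig 3 1 SU2 => g₂) u * (avgKernel B u' u / K1) ∂configMeasure SU2 1 = g₂ * ∫ u, avgKernel B u' u / K1 ∂configMeasure SU2 1 := integral_const_mul _ _
    rw [integral_congr_ae (ae_of_all _ eD), s1, s2, s3, s4, e0, e1, e2, e3, e4, eg]
    ring
  beta_reduce at hDint
  rw [hDint] at hmain
  exact hmain

end Summit.QuantumFields.YangMills.Theorems.FemtoTransferGap.TwoLattice.ConstTube

end
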